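import Summits.Ventures.Crystal3D.Theorems.StickyWulffConstantTextureBuildLayerLateral
import Summits.Ventures.Crystal3D.Theorems.StickyWulffConstantTextureBuildLayerPropagation
import Summits.Ventures.Crystal3D.Theorems.StickyWulffConstantTextureLiminfCubeRigidityLayerSteps
import HarnessLib

/-!
# TB-1 brick L-PROP-4: the DESCENT — layer after layer toward the wall with per-level lateral re-expansion, assembled into ONE Hägg word, with the inclined-twin escape
# (lane T, crux `TextureLiminfV5`, stmt-Ventures-23912; memo HOME/wulff-p2/g25/SLAB-PLATES-g25.md §6 (3))

HONEST FRAMING. Venture `Summits/Ventures/Crystal3D` (cell `crystal3d-full`), route `route-Ventures-StickyWulffConstant`, helper `--supports` the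
law-v5 crux `TextureLiminfV5` (stmt-Ventures-23912).  Census-free, standard axioms: the downward half of `exists_local_stacking_slab` ('…LayerPropagation')
with the disc at each new level RE-EXPANDED by `layerDisc_hcp_local` / `layerDisc_fcc_local` ('…LayerLateral') to a caller-chosen radius.  No cover is built;
F-C1 not moved.

WHY (memo §6).  A single chart cannot feed the cone of `exists_local_stacking_slab` from the charted zone to a wall (the cone loses `2` per layer, charts need
`168×` clearance).  Re-expanding every level along itself removes the obstruction: the radius `N m` at level `m` is limited only by the close-packed shells OF
THAT LEVEL.  On an FCC-type level an HCP-arranged ball is an INCLINED COHERENT TWIN through that ball (memo §6) — the reading must stop there, and the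
theorem says so:

* **`exists_local_stacking_descent`** — base datum `LayerDisc V 0 σ σ' (N 0)`, radii `N m ≥ 2` (`m ≤ K + 1`, all `≤ R`), FCC/HCP arrangements asked only at
  centres `u` with `|u₃ + m·h| ≤ 2` and `‖u‖ ≤ 2m + 2R + 4` for some `m ≤ K + 1`.  Conclusion: a Hägg word `s` such that for every depth `M ≤ K + 1`: IF no
  level `1 ≤ m ≤ M` is FCC-type (`s(−m−1) = s(−m)`) with an HCP-arranged centre among its lattice points of ℓ¹-index `≤ N m + 1` (an inclined-twin witness),
  THEN every site `barlowPos 2 h s (−M) i j`, `|i| + |j| ≤ N M`, is a centre of `V`.  So the presentation is certified down to the plate unless a located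
  coherent twin crosses the column first — exactly the sub-grain boundary the constructor must respect.
The frame transfer to a labelled packing is verbatim that of '…LayerPropagationFrame' (`slabPropagation`); left to the assembly file.
-/

noncomputable section

namespace Summit.Ventures.Crystal3D.Theorems.LocalStacking

open Literature.Geometry.DiscreteGeometry Literature.MathematicalPhysics.StatisticalMechanics
open RealInnerProductSpace Summit.Ventures.Crystal3D.L2B

variable {V : Set (EuclideanSpace ℝ (Fin 3))}

/-- **THE DESCENT WITH RE-EXPANSION.**  See the module docstring. -/
theorem exists_local_stacking_descent (hV : IsUnitBallPacking V) {σ σ' : ℝ} (hσ : σ = 1 ∨ σ = -1) (hσ' : σ' = 1 ∨ σ' = -1)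
    (N : ℕ → ℤ) (K : ℕ) (R : ℤ) (hN2 : ∀ m, m ≤ K + 1 → 2 ≤ N m) (hNR : ∀ m, N m ≤ R)
    (hL : LayerDisc V 0 σ σ' (N 0))
    (hcp : ∀ u ∈ V, ∀ m : ℕ, m ≤ K + 1 → |u 2 + m * layerSpacing| ≤ 2 → ‖u‖ ≤ 2 * m + 2 * R + 4 →
      IsArrangedIn (kissingShell V u) fccKissingPattern ∨ IsArrangedIn (kissingShell V u) hcpKissingPattern) :
    ∃ s : ℤ → ℤ, IsHaggSeq s ∧ ∀ M : ℕ, M ≤ K + 1 →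
      (¬ ∃ m : ℕ, 1 ≤ m ∧ m ≤ M ∧ s (-(m : ℤ) - 1) = s (-(m : ℤ)) ∧ ∃ i j : ℤ, |i| + |j| ≤ N m + 1 ∧
          barlowPos 2 layerSpacing s (-(m : ℤ)) i j ∈ V ∧
          IsArrangedIn (kissingShell V (barlowPos 2 layerSpacing s (-(m : ℤ)) i j)) hcpKissingPattern) →
      ∀ i j : ℤ, |i| + |j| ≤ N M → barlowPos 2 layerSpacing s (-(M : ℤ)) i j ∈ V := by
  classical
  -- the lower type detector, the bases, their norms and heights (as in `exists_local_stacking_slab`)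
  let dnT : (EuclideanSpace ℝ (Fin 3)) → ℤ := fun c => if c + (barlowOffset (2 : ℝ) - layerNormal layerSpacing) ∈ V then 1 else -1
  have dnT_sign : ∀ c, ((dnT c : ℤ) : ℝ) = 1 ∨ ((dnT c : ℤ) : ℝ) = -1 := fun c => by
    simp only [dnT]; split_ifs <;> simp
  have dnT_int : ∀ c, dnT c = 1 ∨ dnT c = -1 := fun c => by simp only [dnT]; split_ifs <;> simp
  have dnT_eq : ∀ {c : (EuclideanSpace ℝ (Fin 3))} {ρ ρ' : ℝ}, (ρ' = 1 ∨ ρ' = -1) → kissingShell V c = layerShell ρ ρ' →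
      ((dnT c : ℤ) : ℝ) = ρ' := by
    intro c ρ ρ' hρ' h; rw [lower_type_eq hρ' h]; simp only [dnT]; split_ifs <;> simp
  let bdn : ℕ → (EuclideanSpace ℝ (Fin 3)) := fun m => Nat.rec (motive := fun _ => (EuclideanSpace ℝ (Fin 3))) 0
    (fun _ b => b + (((dnT b : ℤ) : ℝ) • barlowOffset (2 : ℝ) - layerNormal layerSpacing)) m
  have bdn_zero : bdn 0 = 0 := rfl
  have bdn_succ : ∀ m, bdn (m + 1) = bdn m + (((dnT (bdn m) : ℤ) : ℝ) • barlowOffset (2 : ℝ) - layerNormal layerSpacing) := fun m => rfl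
  have norm_bdn : ∀ m : ℕ, ‖bdn m‖ ≤ 2 * m := by
    intro m
    induction m with
    | zero => simp [bdn_zero]
    | succ m ih =>
      rw [bdn_succ]
      calc ‖bdn m + (((dnT (bdn m) : ℤ) : ℝ) • barlowOffset (2 : ℝ) - layerNormal layerSpacing)‖
            ≤ ‖bdn m‖ + ‖((dnT (bdn m) : ℤ) : ℝ) • (barlowOffset (2 : ℝ)) - layerNormal layerSpacing‖ := norm_add_le _ _
        _ ≤ 2 * m + 2 := by rw [norm_sign_smul_frameW_sub_frameE (dnT_sign _)]; linarith
        _ = 2 * (m + 1 : ℕ) := by push_cast; ring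
  have two_bdn : ∀ m : ℕ, (bdn m) 2 = -(m * layerSpacing) := by
    intro m
    induction m with
    | zero => simp [bdn_zero]
    | succ m ih => rw [bdn_succ, apply_two_frameStep_down, ih]; push_cast; ring
  have hR0 : ∀ m, m ≤ K + 1 → (0 : ℝ) ≤ R := fun m hm => by
    have h1 := hN2 m hm; have h2 := hNR m
    have : (2 : ℤ) ≤ R := h1.trans h2
    exact_mod_cast (le_trans (by norm_num) this)
  -- (a) the descent hypothesis of `layerDisc_down` at level `m ≤ K`
  have cpDown : ∀ m : ℕ, m ≤ K → ∀ i j : ℤ, |i| + |j| ≤ N m → ∀ y ∈ kissingShell V (bdn m + latPt i j),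
      IsArrangedIn (kissingShell V (bdn m + latPt i j + y)) fccKissingPattern ∨
        IsArrangedIn (kissingShell V (bdn m + latPt i j + y)) hcpKissingPattern := by
    intro m hm i j hij y hy
    refine hcp _ hy.1 m (by omega) ?_ ?_
    · have hy2 : |y 2| ≤ 2 := by
        rw [← hy.2]
        have := PiLp.norm_apply_le y 2
        rwa [Real.norm_eq_abs] at this
      have e : (bdn m + latPt i j + y) 2 + m * layerSpacing = y 2 := by
        rw [PiLp.add_apply, PiLp.add_apply, latPt_apply_two, two_bdn]; ring
      rw [e]; exact hy2
    · have hij' : ((|i| + |j| : ℤ) : ℝ) ≤ N m := by exact_mod_cast hij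
      have hNR' : ((N m : ℤ) : ℝ) ≤ R := by exact_mod_cast hNR m
      calc ‖bdn m + latPt i j + y‖ ≤ ‖bdn m‖ + ‖latPt i j‖ + ‖y‖ := norm_add₃_le
        _ ≤ 2 * m + 2 * (|i| + |j| : ℤ) + 2 := by rw [hy.2]; linarith [norm_latPt_le i j, norm_bdn m]
        _ ≤ 2 * m + 2 * R + 4 := by linarith
  -- (b) the re-expansion hypothesis at level `m ≤ K + 1`
  have cpLevel : ∀ m : ℕ, m ≤ K + 1 → ∀ i j : ℤ, |i| + |j| ≤ N m + 1 → bdn m + latPt i j ∈ V →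
      IsArrangedIn (kissingShell V (bdn m + latPt i j)) fccKissingPattern ∨
        IsArrangedIn (kissingShell V (bdn m + latPt i j)) hcpKissingPattern := by
    intro m hm i j hij hmem
    refine hcp _ hmem m hm ?_ ?_
    · have e : (bdn m + latPt i j) 2 + m * layerSpacing = 0 := by
        rw [PiLp.add_apply, latPt_apply_two, two_bdn]; ring
      rw [e, abs_zero]; norm_num
    · have hij' : ((|i| + |j| : ℤ) : ℝ) ≤ N m + 1 := by exact_mod_cast hij
      have hNR' : ((N m : ℤ) : ℝ) ≤ R := by exact_mod_cast hNR m
      calc ‖bdn m + latPt i j‖ ≤ ‖bdn m‖ + ‖latPt i j‖ := norm_add_le _ _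
        _ ≤ 2 * m + 2 * (|i| + |j| : ℤ) := by linarith [norm_latPt_le i j, norm_bdn m]
        _ ≤ 2 * m + 2 * R + 4 := by linarith
  -- the invariant: a disc of radius `N m` at level `m`, unless an inclined-twin witness occurred at a level `≤ m`
  have inv : ∀ m : ℕ, m ≤ K + 1 →
      (∃ τ : ℝ, (τ = 1 ∨ τ = -1) ∧ LayerDisc V (bdn m) τ ((dnT (bdn m) : ℤ) : ℝ) (N m)) ∨
      (∃ m₀ : ℕ, m₀ + 1 ≤ m ∧ ((dnT (bdn (m₀ + 1)) : ℤ) : ℝ) ≠ -((dnT (bdn m₀) : ℤ) : ℝ) ∧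
        ∃ i j : ℤ, |i| + |j| ≤ N (m₀ + 1) + 1 ∧ bdn (m₀ + 1) + latPt i j ∈ V ∧
          IsArrangedIn (kissingShell V (bdn (m₀ + 1) + latPt i j)) hcpKissingPattern) := by
    intro m
    induction m with
    | zero =>
      intro _
      left
      refine ⟨σ, hσ, ?_⟩
      have e : ((dnT 0 : ℤ) : ℝ) = σ' := dnT_eq hσ' (by simpa using (hL 0 0 (by simpa using le_trans (by norm_num) (hN2 0 (by omega)))).2)
      rw [bdn_zero, e]; exact hL
    | succ m ih =>
      intro hm
      have hmK : m ≤ K := by omega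
      rcases ih (by omega) with ⟨τ, hτ, hD⟩ | ⟨m₀, hm₀, hbad⟩
      · -- descend one layer
        obtain ⟨ρ', hρ', hD'⟩ := layerDisc_down hV (dnT_sign (bdn m)) hD (cpDown m hmK)
        rw [← bdn_succ] at hD'
        have hmτ : (-((dnT (bdn m) : ℤ) : ℝ) = 1 ∨ -((dnT (bdn m) : ℤ) : ℝ) = -1) := by
          rcases dnT_sign (bdn m) with h | h <;> rw [h] <;> norm_num
        have h00 := hD' 0 0 (by simp; linarith [hN2 m (by omega)])
        rw [latPt_zero, add_zero] at h00
        obtain ⟨hcV, hSc⟩ := h00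
        have eρ : ((dnT (bdn (m + 1)) : ℤ) : ℝ) = ρ' := dnT_eq hρ' hSc
        by_cases htype : ρ' = -((dnT (bdn m) : ℤ) : ℝ)
        · -- HCP-type level: re-expand with FCC/HCP arrangements
          left
          refine ⟨-((dnT (bdn m) : ℤ) : ℝ), hmτ, ?_⟩
          have hS' : kissingShell V (bdn (m + 1)) = layerShell ρ' ρ' := by rw [hSc, ← htype]
          have h := layerDisc_hcp_local hV hcV hρ' hS' (N (m + 1)) (cpLevel (m + 1) hm)
          rw [eρ, ← htype]; exact h
        · by_cases hw : ∃ i j : ℤ, |i| + |j| ≤ N (m + 1) + 1 ∧ bdn (m + 1) + latPt i j ∈ V ∧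
              IsArrangedIn (kissingShell V (bdn (m + 1) + latPt i j)) hcpKissingPattern
          · -- inclined-twin witness at level `m + 1`
            right
            refine ⟨m, le_rfl, ?_, hw⟩
            rw [eρ]; exact htype
          · -- FCC-type level with no HCP-arranged ball in range: re-expand with FCC arrangements
            left
            push Not at hw
            refine ⟨-((dnT (bdn m) : ℤ) : ℝ), hmτ, ?_⟩
            have h := layerDisc_fcc_local hV hcV hmτ hρ' hSc (N (m + 1)) fun i j hij hmem => by
              rcases cpLevel (m + 1) hm i j hij hmem with h | h
              · exact h
              · exact absurd h (hw i j hij hmem)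
            rw [eρ]; exact h
      · right
        exact ⟨m₀, by omega, hbad⟩
  -- the Hägg word (downward letters read off the packing; upward letters immaterial, set to `1`)
  let sq : ℤ → ℤ := fun k => if 0 ≤ k then 1 else -dnT (bdn (-k - 1).toNat)
  have hsq : IsHaggSeq sq := by
    intro k
    by_cases hk : 0 ≤ k
    · refine Or.inl ?_
      simp only [sq, if_pos hk]
    · simp only [sq, if_neg hk]; rcases dnT_int (bdn (-k - 1).toNat) with h | h <;> rw [h] <;> norm_num
  have sq_neg : ∀ m : ℕ, sq (-((m : ℤ) + 1)) = -dnT (bdn m) := fun m => by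
    have h1 : ¬ (0 : ℤ) ≤ -((m : ℤ) + 1) := by omega
    have h2 : (-(-((m : ℤ) + 1)) - 1).toNat = m := by simp
    simp only [sq, if_neg h1, h2]
  have dn_pos : ∀ m : ℕ, bdn m = (haggLabel sq (-(m : ℤ)) : ℝ) • (barlowOffset (2 : ℝ)) + ((-(m : ℤ) : ℤ) : ℝ) • layerNormal layerSpacing := by
    intro m
    induction m with
    | zero => simp [bdn_zero]
    | succ m ih =>
      have hrec : haggLabel sq (-(m : ℤ)) = haggLabel sq (-((m : ℤ) + 1)) + sq (-((m : ℤ) + 1)) := by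
        have := haggLabel_succ sq (-((m : ℤ) + 1))
        rwa [show -((m : ℤ) + 1) + 1 = -(m : ℤ) by ring] at this
      rw [bdn_succ]
      set ν := dnT (bdn m) with hν
      rw [ih]
      have e : (haggLabel sq (-((m + 1 : ℕ) : ℤ)) : ℝ) = haggLabel sq (-(m : ℤ)) + ν := by
        rw [Nat.cast_succ, hrec, sq_neg m, ← hν]; push_cast; ring
      rw [e]
      push_cast
      module
  -- sites of level `−m` are `bdn m + latPt i j`
  have site : ∀ (m : ℕ) (i j : ℤ), barlowPos 2 layerSpacing sq (-(m : ℤ)) i j = bdn m + latPt i j := by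
    intro m i j
    rw [barlowPos_eq_latPt, add_comm, dn_pos m]
  -- the type of level `−(m₀+1)` in terms of the word
  have typ : ∀ m₀ : ℕ, ((dnT (bdn (m₀ + 1)) : ℤ) : ℝ) ≠ -((dnT (bdn m₀) : ℤ) : ℝ) →
      sq (-((m₀ + 1 : ℕ) : ℤ) - 1) = sq (-((m₀ + 1 : ℕ) : ℤ)) := by
    intro m₀ hne
    have e1 : sq (-((m₀ + 1 : ℕ) : ℤ) - 1) = -dnT (bdn (m₀ + 1)) := by
      rw [show -((m₀ + 1 : ℕ) : ℤ) - 1 = -(((m₀ + 1 : ℕ) : ℤ) + 1) by ring]; exact sq_neg (m₀ + 1)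
    have e2 : sq (-((m₀ + 1 : ℕ) : ℤ)) = -dnT (bdn m₀) := by
      rw [show -((m₀ + 1 : ℕ) : ℤ) = -((m₀ : ℤ) + 1) by push_cast; ring]; exact sq_neg m₀
    rw [e1, e2]
    rcases dnT_int (bdn (m₀ + 1)) with h1 | h1 <;> rcases dnT_int (bdn m₀) with h2 | h2
    · rw [h1, h2]
    · exfalso; apply hne; rw [h1, h2]; norm_num
    · exfalso; apply hne; rw [h1, h2]; norm_num
    · rw [h1, h2]
  -- conclusion
  refine ⟨sq, hsq, fun M hM hnow i j hij => ?_⟩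
  rcases inv M hM with ⟨τ, -, hD⟩ | ⟨m₀, hm₀, hne, i', j', hij', hmem, harr⟩
  · rw [site]; exact (hD i j hij).1
  · exfalso
    refine hnow ⟨m₀ + 1, by omega, hm₀, typ m₀ hne, i', j', hij', ?_, ?_⟩
    · rw [site]; exact hmem
    · rw [site]; exact harr

end Summit.Ventures.Crystal3D.Theorems.LocalStacking

end
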